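import Literature.AlgebraicGeometry.HodgeTheory.BettiHodgeConjectureSurfaceTimesThreefoldOddKunneth
import Literature.AlgebraicGeometry.HodgeTheory.AlgebraicClassesCupDivisorHolds
import HarnessLib

/-!
# `HC(S × S')` for two smooth projective surfaces with `p_g(S) = 0` — UNCONDITIONALLY; `HC(S × S')` and `HC(S × T)` reduce to their middle Künneth pieces with no cup-product hypothesis
# (Voisin I Thm. 11.38–11.40, Lemma 11.41, Thm. 6.25, Thm. 11.30; Voisin II Prop. 9.20 for a divisor, proved in the tree by Voisin 2013 Lemma 2.1)

Family `hodge`, lane `lit-hodgefound` (Track 2 foundations library; Layers A2/A4), layer `Literature/AlgebraicGeometry/HodgeTheory`.  THEOREMS ONLY (no definition, no named fact, no instance;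
D-0026 net debt `0`).  Sequel of the seat's g28-#7/#9 (`BettiHodgeConjectureProductOfSurfacesOddKunneth`) and g28-#8/#10 (`BettiHodgeConjectureSurfaceTimesThreefoldOddKunneth`), whose theorems
carry either Fulton's pull-back lemma `hF : fulton1998_map_mem_algebraicClasses` (a named fact of the tree) or the cup-closure `hcup` of the DIVISOR classes of the product in question.  THE POINT OF
THIS FILE: that cup-closure is a THEOREM of the tree for every smooth projective complex variety — `N¹H² ∪ N¹H² ⊆ N²H⁴`, indeed `NˡH²ˡ ∪ NᵏH²ᵏ ⊆ N^{l+k}` whenever `min(l, k) ≤ 1`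
(`cupProduct_mem_algebraicClasses_of_min_le_one` of `AlgebraicClassesCupDivisorHolds`: Voisin II Prop. 9.20 for a cycle and a divisor, proved with no moving lemma from Deligne's Cor. 8.2.8,
semisimplicity of polarizable Hodge structures and Lefschetz `(1,1)`, along Voisin 2013 Lemma 2.1).  Feeding it to the `…_of_cupProduct` forms removes every hypothesis of that kind.

THE MATHEMATICS (as in g28-#7).  For a smooth projective surface `S` with a rational Kähler class `η` and any smooth projective `Y`, hard Lefschetz `L_η : H¹(S) ⥲ H³(S)(1)` is an isomorphism of
`ℚ`-Hodge structures (Thm. 6.25, Rem. 6.27, Lemma 7.23), so every Hodge class `t` of the Künneth piece `H¹(Y) ⊗ H³(S)` of `H⁴(Y × S)` is `(id ⊗ L_η) u` for a Hodge class `u` of `H¹(Y) ⊗ H¹(S) ⊂ H²(Y × S)`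
— a divisor class (Lefschetz `(1,1)`, Thm. 11.30) — and `crossMap t = pr_S^* η ∪ crossMap u` is the cup product of two divisor classes of `Y × S`, an algebraic class (Prop. 9.20 for divisors).  Hence
for two surfaces the pieces `H⁰⊗H⁴`, `H¹⊗H³`, `H³⊗H¹`, `H⁴⊗H⁰` of `H⁴(S × S')` carry only algebraic Hodge classes and `HC(S × S')` (`⟺ HC²(S × S')`) is EQUIVALENT to the algebraicity of the Hodge
classes of the single piece `H²(S) ⊗ H²(S')`; these are spanned by products of divisor classes as soon as `dim_ℚ Hom_HS(H²(S), H²(S')) ≤ ρ(S)ρ(S')` (Lemma 11.41), which is automatic when `p_g(S) = 0`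
(`H²(S)` of pure type `(1,1)`, Deligne 2.1.13).  Likewise `HC(S × T)` for a surface and a threefold reduces to the two pieces `H¹(S) ⊗ H³(T)` and `H²(S) ⊗ H²(T)` of `H⁴(S × T)`.

THE PRINTS.  C. Voisin (2002) [VoisinHodgeI2002] §11.3.3 Thm. 11.38, Def. 11.39, Thm. 11.40, Lemma 11.41 (p. 286), p. 287; §6.2.3 Thm. 6.25, Rem. 6.27; §7.3.1 Lemma 7.23; §11.3.1 Thm. 11.30;
§11.3.2.  C. Voisin (2003) [VoisinHodgeII2003] §9.2.4 Prop. 9.20.  C. Voisin (2013) [Voisin2013GHCBloch] Lemma 2.1 (proof).  P. Deligne (1971) [DeligneHodgeII1971] 2.1.13–2.1.14.  P. Deligne (2000)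
[Deligne2000] §1.

THE OBJECTS (all the tree's).  `Y Z S S' T : SchemeOver ℂ`, `hS : IsSmoothProjective 2 S`, `hT : IsSmoothProjective 3 T`, `Y ⊗ S = Y ×_ℂ S`; `Hᵏ(X) = BettiUniverse.hodge hHD hX k`; the Künneth summand
`BettiUniverse.kunnethSummand hHD hY hS (2·2) ⟨(i, j), _⟩` and the cross product `BettiUniverse.crossMap`; `ofRatClass`, `algebraicClasses X p = Nᵖ H²ᵖ(X(ℂ); ℂ)`, `HodgeConjectureFor`; `ρ(S) = dim_ℚ Hdg¹(H²(S))`,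
`p_g(S) = h^{2,0}(H²(S))`.

WHAT IS PROVED (no `hF`, no `hcup`, no abelian hypothesis anywhere).
* §1 **The Hodge classes of the Künneth pieces `H¹(Y) ⊗ H³(S)` and `H³(S) ⊗ H¹(Z)` of `H⁴` are algebraic** for a surface `S` and ANY smooth projective `Y`, `Z`
  (`BettiUniverse.ofRatClass_crossMap_mem_algebraicClasses_of_mem_hodgeClasses_one_three`, `…_three_one`).
* §2 TWO SURFACES: **`HC(S ⊗ S')` ⟺ the Hodge classes of the piece `H²(S) ⊗ H²(S')` map to algebraic classes** (`BettiUniverse.hodgeConjectureFor_tensor_surfaces_iff_kunneth_piece_two_two`);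
  **`HC(S ⊗ S')` if `dim_ℚ Hom_HS(H²(S), H²(S')) ≤ ρ(S)ρ(S')`** (`…_of_finrank_hom_le`); **`HC(S ⊗ S')` if `p_g(S) = 0` or `p_g(S') = 0`** (`…_of_pg_zero_left`, `…_of_pg_zero_right`) — the other
  factor is an ARBITRARY smooth projective surface and the irregularities play no role; `HC(S ⊗ S)` for `p_g(S) = 0` (`BettiUniverse.hodgeConjectureFor_tensor_self_of_pg_zero`).
* §3 SURFACE × THREEFOLD: **`HC(S ⊗ T)` as soon as the Hodge classes of the pieces `H¹(S) ⊗ H³(T)` and `H²(S) ⊗ H²(T)` of `H⁴(S × T)` map to algebraic classes**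
  (`BettiUniverse.hodgeConjectureFor_surface_tensor_threefold_of_kunneth_pieces_one_three_two_two`); **`HC(S ⊗ T)` if `Hom_HS(H¹(S), H³(T)(1)) = 0` and `dim_ℚ Hom_HS(H²(S), H²(T)) ≤ ρ(S)ρ(T)`**
  (`…_of_hom_one_three_of_finrank_hom_le`), in particular if `Hom_HS(H¹(S), H³(T)(1)) = 0` and `p_g(S) = 0` or `h^{2,0}(T) = 0` (`…_of_pg_zero_of_hom_one_three`, `…_of_h20_zero_of_hom_one_three`).

DEVIATIONS / SCOPE.  Nothing is assumed beyond smooth projectivity (and the lane's standing binder `hHD : exists_isReal_hodgeModel`); the `(2,2)`-pieces are the genuinely open part (morphisms of Hodge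
structures between transcendental parts), untouched here.  Problem-side the `p_g = 0` case of `S × S'` is also reached through the coniveau route `N¹H⁴(S × S') = H⁴` (Murre 1977, Remark 1;
`Summit…NoetherLefschetzOneUpK3TypeNetsPgZeroFactor`), which Literature does not import; here it drops out of the Künneth analysis together with the finer criteria of §2–§3.

## References
* [VoisinHodgeI2002] C. Voisin, *Hodge Theory and Complex Algebraic Geometry I* (2002) — §11.3.3 Thm. 11.38, Thm. 11.40, Lemma 11.41 (pp. 285–287); §6.2.3 Thm. 6.25, Rem. 6.27; §7.3.1 Lemma 7.23;
  §11.3.1 Thm. 11.30; §11.3.2.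
* [VoisinHodgeII2003] C. Voisin, *Hodge Theory and Complex Algebraic Geometry II* (2003) — §9.2.4 Prop. 9.20.
* [Voisin2013GHCBloch] C. Voisin, *The generalized Hodge and Bloch conjectures are equivalent for general complete intersections*, Ann. Sci. ÉNS 46 (2013) — Lemma 2.1 (proof).
* [DeligneHodgeII1971] P. Deligne, *Théorie de Hodge II* (1971) — 2.1.13–2.1.14.
* [Deligne2000] P. Deligne, *The Hodge conjecture* (Clay, 2000) — §1.

## Provenance
Lane `lit-hodgefound` (Hodge path, Track 2), prover seat `lit-hodgefound-p29` (generation 29), self-proposed row g29-#1: the `hcup`/`hF` hypotheses of the seat's g28-#7…#10 discharged by the tree's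
theorem `cupProduct_mem_algebraicClasses_of_min_le_one` (`AlgebraicClassesCupDivisorHolds`).
-/

noncomputable section

open scoped TensorProduct
open CategoryTheory MonoidalCategory CartesianMonoidalCategory Module Finset
open Literature.AlgebraicTopology.SingularHomology
open Literature.Geometry.Kaehler

namespace Literature.AlgebraicGeometry.HodgeTheory

open Literature.AlgebraicGeometry.Motives
open Literature.AlgebraicGeometry.Motives.HodgeStructure

variable {m n d : ℕ} {X Y Z S S' T : SchemeOver ℂ}

/-! ### §0 The cup product of two divisor classes is algebraic (the tree's theorem, in the shape of the `hcup` hypotheses) -/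

/-- **`N¹H² ∪ N¹H² ⊆ N²H⁴` on every smooth projective complex variety** — the cup-closure `hcup` of the divisor classes asked by the seat's `…_of_cupProduct` theorems, supplied by the tree's
`cupProduct_mem_algebraicClasses_of_min_le_one` (Voisin II Prop. 9.20 for a cycle and a divisor; Voisin 2013 Lemma 2.1). [cite: VoisinHodgeII2003, §9.2.4 Prop. 9.20] [cite: Voisin2013GHCBloch, Lemma 2.1 (proof)] -/
theorem cupProduct_divisorClasses_mem_algebraicClasses (hX : IsSmoothProjective n X) ⦃x y : complexBetti X (2 * 1)⦄ (hx : x ∈ algebraicClasses X 1) (hy : y ∈ algebraicClasses X 1) :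
    cupProduct (two_mul_add_two_mul 1 1) x y ∈ algebraicClasses X (1 + 1) :=
  cupProduct_mem_algebraicClasses_of_min_le_one hX (Or.inl le_rfl) hx hy

/-! ### §1 The odd Künneth pieces `H¹(Y) ⊗ H³(S)`, `H³(S) ⊗ H¹(Z)` (`S` a surface) are algebraic, unconditionally -/

/-- **The Hodge classes of the Künneth piece `H¹(Y) ⊗ H³(S)` of `H⁴(Y × S)` are algebraic** for a smooth projective surface `S` and ANY smooth projective `Y`: for `t ∈ Hdg²(H¹(Y) ⊗ H³(S))`,
`crossMap t ∈ H⁴(Y × S; ℚ)` maps to `N²H⁴(Y × S)`.  Hard Lefschetz `H¹(S) ⥲ H³(S)(1)` writes `t = (id ⊗ L_η) u` with `u` a Hodge class of `H¹(Y) ⊗ H¹(S)`, `crossMap u` is a divisor class (Lefschetz `(1,1)`)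
and `crossMap t = pr_S^* η ∪ crossMap u` is a cup product of two divisor classes — algebraic by Prop. 9.20 for divisors (a theorem of the tree).
[cite: VoisinHodgeI2002, §6.2.3 Thm. 6.25 and Rem. 6.27, §11.3.1 Thm. 11.30, §11.3.3 Thm. 11.38–11.40 and p. 287] [cite: VoisinHodgeII2003, §9.2.4 Prop. 9.20] [cite: Voisin2013GHCBloch, Lemma 2.1 (proof)] -/
theorem BettiUniverse.ofRatClass_crossMap_mem_algebraicClasses_of_mem_hodgeClasses_one_three [HodgeTensorFacts.{0, 0}] (hHD : exists_isReal_hodgeModel) (hY : IsSmoothProjective m Y)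
    (hS : IsSmoothProjective 2 S) (hYS : IsSmoothProjective d (Y ⊗ S)) {t : bettiCohomology Y 1 ⊗[ℚ] bettiCohomology S 3}
    (ht : t ∈ (BettiUniverse.kunnethSummand hHD hY hS (2 * 2) ⟨(1, 3), HasAntidiagonal.mem_antidiagonal.2 rfl⟩).hodgeClasses 2) :
    ofRatClass (ComplexPoints (Y ⊗ S)) (2 * 2) (BettiUniverse.crossMap Y S (show 1 + 3 = 2 * 2 by norm_num) t) ∈ algebraicClasses (Y ⊗ S) 2 :=
  BettiUniverse.ofRatClass_crossMap_mem_algebraicClasses_of_hodge_one_tensor_three_of_cupProduct hHD hY hS hYS (cupProduct_divisorClasses_mem_algebraicClasses hYS) ht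

/-- **The Hodge classes of the Künneth piece `H³(S) ⊗ H¹(Z)` of `H⁴(S × Z)` are algebraic** for a smooth projective surface `S` and ANY smooth projective `Z` (the mirror statement, `L_η ⊗ id`).
[cite: VoisinHodgeI2002, §6.2.3 Thm. 6.25 and Rem. 6.27, §11.3.1 Thm. 11.30, §11.3.3 Thm. 11.38–11.40 and p. 287] [cite: VoisinHodgeII2003, §9.2.4 Prop. 9.20] [cite: Voisin2013GHCBloch, Lemma 2.1 (proof)] -/
theorem BettiUniverse.ofRatClass_crossMap_mem_algebraicClasses_of_mem_hodgeClasses_three_one [HodgeTensorFacts.{0, 0}] (hHD : exists_isReal_hodgeModel) (hS : IsSmoothProjective 2 S)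
    (hZ : IsSmoothProjective n Z) (hSZ : IsSmoothProjective d (S ⊗ Z)) {t : bettiCohomology S 3 ⊗[ℚ] bettiCohomology Z 1}
    (ht : t ∈ (BettiUniverse.kunnethSummand hHD hS hZ (2 * 2) ⟨(3, 1), HasAntidiagonal.mem_antidiagonal.2 rfl⟩).hodgeClasses 2) :
    ofRatClass (ComplexPoints (S ⊗ Z)) (2 * 2) (BettiUniverse.crossMap S Z (show 3 + 1 = 2 * 2 by norm_num) t) ∈ algebraicClasses (S ⊗ Z) 2 :=
  BettiUniverse.ofRatClass_crossMap_mem_algebraicClasses_of_hodge_three_tensor_one_of_cupProduct hHD hS hZ hSZ (cupProduct_divisorClasses_mem_algebraicClasses hSZ) ht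

/-! ### §2 Two surfaces -/

/-- **`HC(S ⊗ S')` for two smooth projective surfaces as soon as the Hodge classes of the Künneth piece `H²(S) ⊗ H²(S')` of `H⁴(S × S')` map to algebraic classes** — UNCONDITIONALLY: the four
other pieces `H⁰⊗H⁴`, `H¹⊗H³`, `H³⊗H¹`, `H⁴⊗H⁰` carry only algebraic Hodge classes (§1) and `HC(S ⊗ S') ⟺ HC²(S ⊗ S')`. [cite: VoisinHodgeI2002, §11.3.3 Thm. 11.38, Thm. 11.40, Lemma 11.41 and p. 287,
§11.3.1 Thm. 11.30, §6.2.3 Thm. 6.25] [cite: Deligne2000, §1] [cite: VoisinHodgeII2003, §9.2.4 Prop. 9.20] -/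
theorem BettiUniverse.hodgeConjectureFor_tensor_surfaces_of_kunneth_piece_two_two [HodgeTensorFacts.{0, 0}] (hHD : exists_isReal_hodgeModel) (hS : IsSmoothProjective 2 S)
    (hS' : IsSmoothProjective 2 S') (hSS' : IsSmoothProjective 4 (S ⊗ S'))
    (halg : ∀ t ∈ (BettiUniverse.kunnethSummand hHD hS hS' (2 * 2) ⟨(2, 2), HasAntidiagonal.mem_antidiagonal.2 rfl⟩).hodgeClasses 2,
      ofRatClass (ComplexPoints (S ⊗ S')) (2 * 2) (BettiUniverse.crossMap S S' (show 2 + 2 = 2 * 2 by norm_num) t) ∈ algebraicClasses (S ⊗ S') 2) :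
    HodgeConjectureFor 4 (S ⊗ S') :=
  BettiUniverse.hodgeConjectureFor_tensor_surfaces_of_kunneth_two_two_of_cupProduct hHD hS hS' hSS' (cupProduct_divisorClasses_mem_algebraicClasses hSS') halg

/-- **Conversely, `HC(S ⊗ S')` makes the Hodge classes of the piece `H²(S) ⊗ H²(S')` algebraic** (their cross products are rational `(2,2)`-classes of `H⁴(S × S')`, Thm. 11.40); so for two smooth
projective surfaces **`HC(S × S')` IS EQUIVALENT to the algebraicity of the Hodge classes of `H²(S) ⊗ H²(S')`**. [cite: VoisinHodgeI2002, §11.3.3 Thm. 11.38–11.40 and p. 287] [cite: Deligne2000, §1] -/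
theorem BettiUniverse.hodgeConjectureFor_tensor_surfaces_iff_kunneth_piece_two_two [HodgeTensorFacts.{0, 0}] (hHD : exists_isReal_hodgeModel) (hS : IsSmoothProjective 2 S)
    (hS' : IsSmoothProjective 2 S') (hSS' : IsSmoothProjective 4 (S ⊗ S')) :
    HodgeConjectureFor 4 (S ⊗ S') ↔
      ∀ t ∈ (BettiUniverse.kunnethSummand hHD hS hS' (2 * 2) ⟨(2, 2), HasAntidiagonal.mem_antidiagonal.2 rfl⟩).hodgeClasses 2,
        ofRatClass (ComplexPoints (S ⊗ S')) (2 * 2) (BettiUniverse.crossMap S S' (show 2 + 2 = 2 * 2 by norm_num) t) ∈ algebraicClasses (S ⊗ S') 2 := by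
  refine ⟨fun hHC t ht ↦ ?_, BettiUniverse.hodgeConjectureFor_tensor_surfaces_of_kunneth_piece_two_two hHD hS hS' hSS'⟩
  have hv : BettiUniverse.crossMap S S' (show 2 + 2 = 2 * 2 by norm_num) t ∈ (BettiUniverse.hodge hHD hSS' (2 * 2)).hodgeClasses 2 :=
    BettiUniverse.crossMap_mem_hodgeClasses hHD hodgePQ_independent_of_hodgeModel_holds hS hS' hSS' (show 2 + 2 = 2 * 2 by norm_num) 2 ht
  exact hHC.2 2 _ (isRationalClass_ofRatClass _) ((BettiUniverse.mem_hodgeClasses_hodge_iff_isOfHodgeType hHD hSS' 2 _).1 hv)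

/-- **`HC(S ⊗ S')` for two smooth projective surfaces with `dim_ℚ Hom_HS(H²(S), H²(S')) ≤ ρ(S)ρ(S')`** — UNCONDITIONALLY (then the Hodge classes of `H²(S) ⊗ H²(S')`, as many as
`dim Hom_HS(H²S, H²S')` by Lemma 11.41, are spanned by the `ρρ'` products of divisor classes); e.g. two surfaces whose transcendental `ℚ`-Hodge structures `T(S)`, `T(S')` admit no non-zero morphism.
[cite: VoisinHodgeI2002, §11.3.3 Lemma 11.41, p. 287, Thm. 11.30 and §6.2.3 Thm. 6.25] [cite: Deligne2000, §1] [cite: VoisinHodgeII2003, §9.2.4 Prop. 9.20] -/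
theorem BettiUniverse.hodgeConjectureFor_tensor_surfaces_of_finrank_hom_le (hHD : exists_isReal_hodgeModel) (hS : IsSmoothProjective 2 S) (hS' : IsSmoothProjective 2 S')
    (hSS' : IsSmoothProjective 4 (S ⊗ S'))
    (h22 : Module.finrank ℚ (HodgeStructure.Hom (BettiUniverse.hodge hHD hS 2) (BettiUniverse.hodge hHD hS' 2)) ≤
      Module.finrank ℚ ↥((BettiUniverse.hodge hHD hS 2).hodgeClasses 1) * Module.finrank ℚ ↥((BettiUniverse.hodge hHD hS' 2).hodgeClasses 1)) :
    HodgeConjectureFor 4 (S ⊗ S') :=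
  BettiUniverse.hodgeConjectureFor_tensor_surfaces_of_finrank_hom_le_of_cupProduct hHD hS hS' hSS' (cupProduct_divisorClasses_mem_algebraicClasses hSS') h22

/-- **`HC(S × S')` for every pair of smooth projective surfaces with `p_g(S) = 0`** — UNCONDITIONALLY, the surface `S'` and the irregularities `q(S)`, `q(S')` being arbitrary: `H²(S)` is of pure type
`(1,1)` (`h^{2,0} = 0`), all of `H²(S;ℚ)` consists of divisor classes (Thm. 11.30), the Hodge classes of `H²(S) ⊗ H²(S')` are `H²(S) ⊗ NS(S')_ℚ` (Deligne 2.1.13), products of divisor classes.  Covers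
`S` rational or ruled (over a curve of any genus), Enriques, bielliptic, and the surfaces of general type with `p_g = 0` (Godeaux, Campedelli, Burniat, …), times ANY surface `S'` (K3, abelian, general type, …).
[cite: VoisinHodgeI2002, §11.3.3 Lemma 11.41, p. 287, Thm. 11.30, §6.2.3 Thm. 6.25 and §6.1.3 Cor. 6.13] [cite: DeligneHodgeII1971, 2.1.13] [cite: Deligne2000, §1] [cite: VoisinHodgeII2003, §9.2.4 Prop. 9.20] -/
theorem BettiUniverse.hodgeConjectureFor_tensor_surfaces_of_pg_zero_left (hHD : exists_isReal_hodgeModel) (hS : IsSmoothProjective 2 S) (hS' : IsSmoothProjective 2 S')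
    (hSS' : IsSmoothProjective 4 (S ⊗ S')) (hpg : (BettiUniverse.hodge hHD hS 2).hodgeNumber 2 0 = 0) : HodgeConjectureFor 4 (S ⊗ S') := by
  haveI : HodgeTensorFacts.{0, 0} := hodgeTensorFacts_holds
  haveI := BettiUniverse.finite hS 2
  haveI := BettiUniverse.finite hS' 2
  refine BettiUniverse.hodgeConjectureFor_tensor_surfaces_of_finrank_hom_le hHD hS hS' hSS' (le_of_eq ?_)
  have htop : (BettiUniverse.hodge hHD hS 2).hodgeClasses 1 = ⊤ := (BettiUniverse.hodgeClasses_hodge_two_eq_top_iff hHD hS).2 hpg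
  have e := BettiUniverse.finrank_hodgeClasses_tensor_hodge_of_hodgeClasses_eq_top_left hHD hS hS' (i := 2) (a := 1) (by norm_num) htop 2 1
  rw [show (1 : ℤ) + 1 = ((2 : ℕ) : ℤ) by norm_num] at e
  rw [← BettiUniverse.finrank_hodgeClasses_tensor_hodge_eq_finrank_hom hHD hS hS' 2, e, htop, finrank_top]

/-- **`HC(S × S')` for every pair of smooth projective surfaces with `p_g(S') = 0`** — UNCONDITIONALLY (the mirror statement). [cite: VoisinHodgeI2002, §11.3.3 Lemma 11.41, p. 287, Thm. 11.30 and §6.2.3 Thm. 6.25]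
[cite: DeligneHodgeII1971, 2.1.13] [cite: Deligne2000, §1] [cite: VoisinHodgeII2003, §9.2.4 Prop. 9.20] -/
theorem BettiUniverse.hodgeConjectureFor_tensor_surfaces_of_pg_zero_right (hHD : exists_isReal_hodgeModel) (hS : IsSmoothProjective 2 S) (hS' : IsSmoothProjective 2 S')
    (hSS' : IsSmoothProjective 4 (S ⊗ S')) (hpg : (BettiUniverse.hodge hHD hS' 2).hodgeNumber 2 0 = 0) : HodgeConjectureFor 4 (S ⊗ S') := by
  haveI : HodgeTensorFacts.{0, 0} := hodgeTensorFacts_holds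
  haveI := BettiUniverse.finite hS 2
  haveI := BettiUniverse.finite hS' 2
  refine BettiUniverse.hodgeConjectureFor_tensor_surfaces_of_finrank_hom_le hHD hS hS' hSS' (le_of_eq ?_)
  have htop : (BettiUniverse.hodge hHD hS' 2).hodgeClasses 1 = ⊤ := (BettiUniverse.hodgeClasses_hodge_two_eq_top_iff hHD hS').2 hpg
  have e := BettiUniverse.finrank_hodgeClasses_tensor_hodge_of_hodgeClasses_eq_top_right hHD hS hS' 2 (j := 2) (a := 1) (by norm_num) htop 1
  rw [show (1 : ℤ) + 1 = ((2 : ℕ) : ℤ) by norm_num] at e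
  rw [← BettiUniverse.finrank_hodgeClasses_tensor_hodge_eq_finrank_hom hHD hS hS' 2, e, htop, finrank_top]

/-- **`HC(S × S)` for every smooth projective surface with `p_g(S) = 0`** — UNCONDITIONALLY (ruled surfaces over a curve of any genus, bielliptic, Enriques, Godeaux, …).
[cite: VoisinHodgeI2002, §11.3.3 Lemma 11.41, p. 287, Thm. 11.30 and §6.2.3 Thm. 6.25] [cite: Deligne2000, §1] [cite: VoisinHodgeII2003, §9.2.4 Prop. 9.20] -/
theorem BettiUniverse.hodgeConjectureFor_tensor_self_of_pg_zero (hHD : exists_isReal_hodgeModel) (hS : IsSmoothProjective 2 S) (hSS : IsSmoothProjective 4 (S ⊗ S))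
    (hpg : (BettiUniverse.hodge hHD hS 2).hodgeNumber 2 0 = 0) : HodgeConjectureFor 4 (S ⊗ S) :=
  BettiUniverse.hodgeConjectureFor_tensor_surfaces_of_pg_zero_left hHD hS hS hSS hpg

/-- **`HC(S × S')` when all of `H²(S;ℚ)` consists of Hodge classes** (`Hdg¹(H²(S)) = H²(S;ℚ)`, the same hypothesis as `p_g(S) = 0` in the lane's dictionary `hodgeClasses_hodge_two_eq_top_iff`), `S'` any
smooth projective surface. [cite: VoisinHodgeI2002, §11.3.3 Lemma 11.41, p. 287 and Thm. 11.30] [cite: DeligneHodgeII1971, 2.1.13] [cite: Deligne2000, §1] -/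
theorem BettiUniverse.hodgeConjectureFor_tensor_surfaces_of_hodgeClasses_two_eq_top_left (hHD : exists_isReal_hodgeModel) (hS : IsSmoothProjective 2 S) (hS' : IsSmoothProjective 2 S')
    (hSS' : IsSmoothProjective 4 (S ⊗ S')) (htop : (BettiUniverse.hodge hHD hS 2).hodgeClasses 1 = ⊤) : HodgeConjectureFor 4 (S ⊗ S') :=
  BettiUniverse.hodgeConjectureFor_tensor_surfaces_of_pg_zero_left hHD hS hS' hSS' ((BettiUniverse.hodgeClasses_hodge_two_eq_top_iff hHD hS).1 htop)

/-! ### §3 A surface times a threefold -/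

/-- **`HC(S ⊗ T)` (`S` a surface, `T` a threefold) as soon as the Hodge classes of the Künneth pieces `H¹(S) ⊗ H³(T)` and `H²(S) ⊗ H²(T)` of `H⁴(S × T)` map to algebraic classes** — UNCONDITIONALLY:
`HC(S ⊗ T) ⟺ HC²(S ⊗ T)` for the fivefold, and the pieces `H⁰⊗H⁴` (codimension `2 = dim T − 1` on `T`), `H³⊗H¹` (§1), `H⁴⊗H⁰` are algebraic. [cite: VoisinHodgeI2002, §11.3.3 Thm. 11.38, Thm. 11.40, Lemma 11.41 and p. 287,
§11.3.1 Thm. 11.30, §6.2.3 Thm. 6.25] [cite: Deligne2000, §1] [cite: VoisinHodgeII2003, §9.2.4 Prop. 9.20] -/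
theorem BettiUniverse.hodgeConjectureFor_surface_tensor_threefold_of_kunneth_pieces_one_three_two_two [HodgeTensorFacts.{0, 0}] (hHD : exists_isReal_hodgeModel)
    (hS : IsSmoothProjective 2 S) (hT : IsSmoothProjective 3 T) (hST : IsSmoothProjective 5 (S ⊗ T))
    (h13 : ∀ t ∈ (BettiUniverse.kunnethSummand hHD hS hT (2 * 2) ⟨(1, 3), HasAntidiagonal.mem_antidiagonal.2 rfl⟩).hodgeClasses 2,
      ofRatClass (ComplexPoints (S ⊗ T)) (2 * 2) (BettiUniverse.crossMap S T (show 1 + 3 = 2 * 2 by norm_num) t) ∈ algebraicClasses (S ⊗ T) 2)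
    (h22 : ∀ t ∈ (BettiUniverse.kunnethSummand hHD hS hT (2 * 2) ⟨(2, 2), HasAntidiagonal.mem_antidiagonal.2 rfl⟩).hodgeClasses 2,
      ofRatClass (ComplexPoints (S ⊗ T)) (2 * 2) (BettiUniverse.crossMap S T (show 2 + 2 = 2 * 2 by norm_num) t) ∈ algebraicClasses (S ⊗ T) 2) :
    HodgeConjectureFor 5 (S ⊗ T) :=
  BettiUniverse.hodgeConjectureFor_surface_tensor_threefold_of_kunneth_pieces_of_cupProduct hHD hS hT hST (cupProduct_divisorClasses_mem_algebraicClasses hST) h13 h22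

/-- **`HC(S ⊗ T)` for a surface `S` and a threefold `T` with `Hom_HS(H¹(S), H³(T)(1)) = 0` and `dim_ℚ Hom_HS(H²(S), H²(T)) ≤ ρ(S)ρ(T)`** — UNCONDITIONALLY (the seat's g27-#11 / g28-#1 / g28-#8 criterion with
neither the condition `Hom_HS(H¹S, H¹T) = 0` nor a cup-product hypothesis). [cite: VoisinHodgeI2002, §11.3.3 Lemma 11.41, p. 287, Thm. 11.30 and §6.2.3 Thm. 6.25] [cite: Deligne2000, §1] [cite: VoisinHodgeII2003, §9.2.4 Prop. 9.20] -/
theorem BettiUniverse.hodgeConjectureFor_surface_tensor_threefold_of_hom_one_three_of_finrank_hom_le (hHD : exists_isReal_hodgeModel) (hS : IsSmoothProjective 2 S) (hT : IsSmoothProjective 3 T)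
    (hST : IsSmoothProjective 5 (S ⊗ T)) (h13 : Subsingleton (HodgeStructure.Hom (BettiUniverse.hodge hHD hS 1) (((BettiUniverse.hodge hHD hT 3).tateTwist 1).cast (by norm_num))))
    (h22 : Module.finrank ℚ (HodgeStructure.Hom (BettiUniverse.hodge hHD hS 2) (BettiUniverse.hodge hHD hT 2)) ≤
      Module.finrank ℚ ↥((BettiUniverse.hodge hHD hS 2).hodgeClasses 1) * Module.finrank ℚ ↥((BettiUniverse.hodge hHD hT 2).hodgeClasses 1)) :
    HodgeConjectureFor 5 (S ⊗ T) :=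
  BettiUniverse.hodgeConjectureFor_surface_tensor_threefold_of_hom_of_cupProduct hHD hS hT hST (cupProduct_divisorClasses_mem_algebraicClasses hST) h13 h22

/-- **`HC(S ⊗ T)` if `Hom_HS(H¹(S), H³(T)(1)) = 0` and `p_g(S) = 0`** — UNCONDITIONALLY (`H²(S)` of pure type `(1,1)` forces `dim Hom_HS(H²S, H²T) = ρ(S)ρ(T)`); e.g. an Enriques or a rational surface
times any threefold `T` with `Hom_HS(H¹(S), H³(T)(1)) = 0` (automatic when `q(S) = 0`). [cite: VoisinHodgeI2002, §11.3.3 Lemma 11.41, p. 287, Thm. 11.30 and §6.2.3 Thm. 6.25] [cite: DeligneHodgeII1971, 2.1.13] [cite: Deligne2000, §1]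
[cite: VoisinHodgeII2003, §9.2.4 Prop. 9.20] -/
theorem BettiUniverse.hodgeConjectureFor_surface_tensor_threefold_of_pg_zero_of_hom_one_three (hHD : exists_isReal_hodgeModel) (hS : IsSmoothProjective 2 S) (hT : IsSmoothProjective 3 T)
    (hST : IsSmoothProjective 5 (S ⊗ T)) (hpg : (BettiUniverse.hodge hHD hS 2).hodgeNumber 2 0 = 0)
    (h13 : Subsingleton (HodgeStructure.Hom (BettiUniverse.hodge hHD hS 1) (((BettiUniverse.hodge hHD hT 3).tateTwist 1).cast (by norm_num)))) : HodgeConjectureFor 5 (S ⊗ T) := by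
  haveI : HodgeTensorFacts.{0, 0} := hodgeTensorFacts_holds
  haveI := BettiUniverse.finite hS 2
  haveI := BettiUniverse.finite hT 2
  refine BettiUniverse.hodgeConjectureFor_surface_tensor_threefold_of_hom_one_three_of_finrank_hom_le hHD hS hT hST h13 (le_of_eq ?_)
  have htop : (BettiUniverse.hodge hHD hS 2).hodgeClasses 1 = ⊤ := (BettiUniverse.hodgeClasses_hodge_two_eq_top_iff hHD hS).2 hpg
  have e := BettiUniverse.finrank_hodgeClasses_tensor_hodge_of_hodgeClasses_eq_top_left hHD hS hT (i := 2) (a := 1) (by norm_num) htop 2 1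
  rw [show (1 : ℤ) + 1 = ((2 : ℕ) : ℤ) by norm_num] at e
  rw [← BettiUniverse.finrank_hodgeClasses_tensor_hodge_eq_finrank_hom hHD hS hT 2, e, htop, finrank_top]

/-- **`HC(S ⊗ T)` if `Hom_HS(H¹(S), H³(T)(1)) = 0` and `h^{2,0}(T) = 0`** — UNCONDITIONALLY (the mirror: `H²(T)` of pure type `(1,1)`). [cite: VoisinHodgeI2002, §11.3.3 Lemma 11.41, p. 287, Thm. 11.30 and §6.2.3 Thm. 6.25]
[cite: DeligneHodgeII1971, 2.1.13] [cite: Deligne2000, §1] [cite: VoisinHodgeII2003, §9.2.4 Prop. 9.20] -/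
theorem BettiUniverse.hodgeConjectureFor_surface_tensor_threefold_of_h20_zero_of_hom_one_three (hHD : exists_isReal_hodgeModel) (hS : IsSmoothProjective 2 S) (hT : IsSmoothProjective 3 T)
    (hST : IsSmoothProjective 5 (S ⊗ T)) (h20 : (BettiUniverse.hodge hHD hT 2).hodgeNumber 2 0 = 0)
    (h13 : Subsingleton (HodgeStructure.Hom (BettiUniverse.hodge hHD hS 1) (((BettiUniverse.hodge hHD hT 3).tateTwist 1).cast (by norm_num)))) : HodgeConjectureFor 5 (S ⊗ T) := by
  haveI : HodgeTensorFacts.{0, 0} := hodgeTensorFacts_holds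
  haveI := BettiUniverse.finite hS 2
  haveI := BettiUniverse.finite hT 2
  refine BettiUniverse.hodgeConjectureFor_surface_tensor_threefold_of_hom_one_three_of_finrank_hom_le hHD hS hT hST h13 (le_of_eq ?_)
  have htop : (BettiUniverse.hodge hHD hT 2).hodgeClasses 1 = ⊤ := (BettiUniverse.hodgeClasses_hodge_two_eq_top_iff hHD hT).2 h20
  have e := BettiUniverse.finrank_hodgeClasses_tensor_hodge_of_hodgeClasses_eq_top_right hHD hS hT 2 (j := 2) (a := 1) (by norm_num) htop 1
  rw [show (1 : ℤ) + 1 = ((2 : ℕ) : ℤ) by norm_num] at e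
  rw [← BettiUniverse.finrank_hodgeClasses_tensor_hodge_eq_finrank_hom hHD hS hT 2, e, htop, finrank_top]

/-- **`HC(S ⊗ T)` for a REGULAR surface (`q(S) = 0`) with `p_g(S) = 0` and ANY smooth projective threefold `T`** — UNCONDITIONALLY: `H¹(S) = 0` kills the piece `H¹(S) ⊗ H³(T)`; e.g. an Enriques surface,
a rational surface or a Godeaux surface times an arbitrary threefold. [cite: VoisinHodgeI2002, §11.3.3 Lemma 11.41, p. 287, Thm. 11.30, §6.1.3 Cor. 6.13 and §6.2.3 Thm. 6.25] [cite: Deligne2000, §1] [cite: VoisinHodgeII2003, §9.2.4 Prop. 9.20] -/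
theorem BettiUniverse.hodgeConjectureFor_surface_tensor_threefold_of_pg_zero_of_q_zero (hHD : exists_isReal_hodgeModel) (hS : IsSmoothProjective 2 S) (hT : IsSmoothProjective 3 T)
    (hST : IsSmoothProjective 5 (S ⊗ T)) (hpg : (BettiUniverse.hodge hHD hS 2).hodgeNumber 2 0 = 0) (hq : (BettiUniverse.hodge hHD hS 1).hodgeNumber 1 0 = 0) : HodgeConjectureFor 5 (S ⊗ T) := by
  haveI := BettiUniverse.finite hS 1
  have h1 : Module.finrank ℚ (bettiCohomology S 1) = 0 := (BettiUniverse.finrank_bettiCohomology_one_eq_zero_iff hHD hS).2 hq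
  haveI : Subsingleton (bettiCohomology S 1) := Module.finrank_zero_iff.1 h1
  exact BettiUniverse.hodgeConjectureFor_surface_tensor_threefold_of_pg_zero_of_hom_one_three hHD hS hT hST hpg HodgeStructure.Hom.toLinearMap_injective.subsingleton

end Literature.AlgebraicGeometry.HodgeTheory

end
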